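import Literature.AlgebraicGeometry.HodgeTheory.SmallChowGroupsHodgeConjectureHolds
import Literature.AlgebraicGeometry.Motives.CompleteIntersectionChowGroups
import Mathlib.Algebra.CharP.Algebra
import HarnessLib

/-!
# The Hodge conjecture for every smooth complete intersection of at most four quadrics, from their small Chow groups (Otwinowska 1999 ∘ Laterveer 1998 / Vial 2013 Thm. 7.1 (i)) — proved assembly

Family `hodge`, layer `Literature/AlgebraicGeometry/HodgeTheory`. PROVED glue, no new fact (D-0026) —
the sibling of `CubicEightfoldHodgeConjectureOfChowGroups` for complete intersections of quadrics, written
for cell hodge-nonav (memo ROUTE-P3v2 §1, rung R1; the memo's sketch `HodgeNonav.P3v2.hcQuadricCI_of_chow`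
is this file's main theorem). For a smooth projective complex `m`-fold `X`, Vial 2013 Thm. 7.1 (i)
(Laterveer 1998) — the tree's theorem `Vial2013_hodgeConjectureFor_of_chowGroups_rank_le_one_holds` —
gives `HodgeConjectureFor m X` as soon as `CH_i(X_L) ⊗ ℚ` has rank `≤ 1` for every `i ≤ ⌊(m−4)/2⌋` and
every algebraically closed `L ⊇ ℂ`. If `X` is a smooth complete intersection of `c` quadrics in
`ℙ^{m+c}`, Otwinowska 1999 (Paranjape's conjecture for quadrics — the statement is the binder
`hCH` below; it is NOT vendored as a named fact in this file) gives rank `≤ 1` for every `i` with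
`2 i + c ≤ m`;
for `c ≤ 4` (and `c ≤ m`) this contains Vial's range. Hence: **HC for EVERY smooth complete
intersection of `c ≤ 4` quadrics of dimension `m ≥ c`** — in particular for the two infinite
even-dimensional series of Hodge level two off the abelian locus, `(2,2,2)^{2p} ⊂ ℙ^{2p+3}` and
`(2,2,2,2)^{2p} ⊂ ℙ^{2p+4}`, all `p ≥ 2` (previously in print only for generic members: O'Grady 1986,
Terasoma 1988 Thm. 4.5.2 / 4.6.2, Nagel 2023 Cor. 5.5; and, a second printed road to all members, Voisin
2015 Thm. 6). The corollary is PRINT-IMPLIED (Otwinowska 1999 ∘ Vial 2013 Thm. 7.1 (i), as recorded in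
memo ROUTE-P3v2 §0), not printed as a sentence — hence assembled here as a theorem from the Chow
hypothesis, never vendored as a fact of its own. A third printed road to the same corollary needs no
Chow input on `X` at all: Vial 2013 Prop. 7.4 (iii) (a smooth projective variety fibred in quadric
hypersurfaces over a base of dimension `≤ 3` satisfies HC) applied to the total space
`{(λ, x) | x ∈ Q_λ} → ℙ^{c−1}` of the linear system, which is smooth iff `X` is, followed by Cayley's
trick (Jiang 2023 Cor. 3.2: `h(X)(c−1)` is a direct summand of the motive of that total space; for
nets O'Grady 1986 Thm. 1.1); that road is not formalised here. For `c = 1, 2` (quadrics,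
intersections of two quadrics) HC is classical (cellular / Reid 1972); the statement below covers them
uniformly.

WHAT IS AN EXPLICIT HYPOTHESIS (exactly as in the cubic-eightfold sibling): the Chow input `hCH`, whose
binder shape is that of Otwinowska's statement at universe `0` (kept as a hypothesis of this shape, so
that any proof or named fact of the Chow statement feeds the same theorem),
and the routine base-change bridge `hbc` "the base change `X_L` of a smooth complete intersection of `c`
quadrics over `ℂ` to an algebraically closed `L ⊇ ℂ` is again one" (Jacobian criterion under field
extension; absent from the tree). The dimension hypotheses: `c ≤ 4` (Vial's range `i ≤ ⌊(m−4)/2⌋` must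
sit inside `2 i + c ≤ m`) and `c ≤ m` (for `m < 4` Vial still asks for `CH₀`; e.g. the `(2,2,2)` K3
surface, `m = 2 < 3 = c`, is rightly NOT covered by this road — Mumford).

## References

* [Otwinowska1999b] A. Otwinowska, C. R. Acad. Sci. Paris Sér. I Math. 329 (1999), no. 2, 141–146, Théorème (1).
* [BernardaraTabuada2016] M. Bernardara, G. Tabuada, Izv. Math. 80 (2016), §1 (restatement).
* [Vial2013] Ch. Vial, Algebraic cycles and fibrations, Doc. Math. 18 (2013), Thm. 7.1 (i).
* [Laterveer1998] R. Laterveer, Algebraic varieties with small Chow groups, J. Math. Kyoto Univ. 38 (1998).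
* [Terasoma1988QuadricCI] T. Terasoma, Japan. J. Math. 14 (1988), Thm. 4.5.2, 4.6.2 (generic members).
* [Voisin2015GHCBlochII] C. Voisin, J. Math. Sci. Univ. Tokyo 22 (2015), Thm. 6 (generic ⇒ all members, Chow level).
* [Jiang2023ChowProjectivizations] Q. Jiang, J. Inst. Math. Jussieu 22 (2023), Thm. 3.1, Cor. 3.2 (Cayley's trick).
* [OGrady1986ThreeQuadrics] K. O'Grady, Math. Ann. 273 (1986), Thm. 1.1.
-/

noncomputable section

namespace Literature.AlgebraicGeometry.HodgeTheory

section HodgeTheory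

/-- **HC for an `m`-fold all of whose algebraically closed base changes are smooth complete
intersections of `c ≤ 4` quadrics (`c ≤ m`), granted the Chow input.** For a smooth projective complex
`m`-fold `X` such that `X_L ⊂ ℙ^{m+c}_L` is a smooth complete intersection of `c` quadrics for every
algebraically closed `L ⊇ ℂ` (`L` is then of characteristic `0`): `CH_i(X_L) ⊗ ℚ` has rank `≤ 1` for
`i ≤ ⌊(m−4)/2⌋` by the Chow input `hCH` (Otwinowska's statement at universe `0`;
`2 i + c ≤ (m−4) + 4`), so
Vial 2013 Thm. 7.1 (i) (the tree's theorem `Vial2013_hodgeConjectureFor_of_chowGroups_rank_le_one_holds`)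
gives `HodgeConjectureFor m X`. [cite: Vial2013, Thm 7.1 (i)] [cite: Otwinowska1999b, Théorème (1)] -/
theorem hodgeConjectureFor_of_baseChange_ciQuadrics
    (hCH : ∀ ⦃k : Type⦄ [Field k] [IsAlgClosed k] [CharZero k] ⦃m c : ℕ⦄ ⦃Y : Motives.SchemeOver k⦄,
      Motives.IsSmoothCompleteIntersection m (fun _ : Fin c ↦ 2) Y → ∀ ⦃l : ℕ⦄, 2 * l + c ≤ m →
        ∀ x y : Motives.ChowGroup Y.left l, ∃ p q : ℤ, (p ≠ 0 ∨ q ≠ 0) ∧ p • x = q • y)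
    {m c : ℕ} (hc : c ≤ 4) (hcm : c ≤ m) {X : Motives.SchemeOver ℂ} (hX : Motives.IsSmoothProjective m X)
    (hbc : ∀ (L : Type) [Field L] [IsAlgClosed L] [Algebra ℂ L],
      Motives.IsSmoothCompleteIntersection m (fun _ : Fin c ↦ 2) ((Motives.baseChange ℂ L).obj X)) :
    HodgeConjectureFor m X := by
  refine Vial2013_hodgeConjectureFor_of_chowGroups_rank_le_one_holds hX fun L _ _ _ i hi a b ↦ ?_
  haveI : CharZero L := charZero_of_injective_algebraMap (algebraMap ℂ L).injective
  exact hCH (hbc L) (by omega) a b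

/-- **The Hodge conjecture for EVERY smooth complete intersection of `c ≤ 4` quadrics in `ℙ^{m+c}_ℂ`,
`m ≥ c`** (`Motives.IsSmoothCompleteIntersection m (fun _ : Fin c ↦ 2) X`, the spelling of the Chow fact
and of memo ROUTE-P3v2's target `HCQuadricCI m c`), granted the Chow input `hCH` (Otwinowska 1999b Théorème (1), as restated in Bernardara–Tabuada 2016
§1) and the routine base-change bridge `hbc`.
In every codimension; for `2p ≠ m` this is Lefschetz, for `m = 2p` and `c = 3, 4` it is the level-two
middle cohomology. [cite: Otwinowska1999b, Théorème (1)] [cite: Vial2013, Thm 7.1 (i)]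
[cite: BernardaraTabuada2016, §1] -/
theorem hodgeConjectureFor_ciQuadrics_of_chow
    (hCH : ∀ ⦃k : Type⦄ [Field k] [IsAlgClosed k] [CharZero k] ⦃m c : ℕ⦄ ⦃Y : Motives.SchemeOver k⦄,
      Motives.IsSmoothCompleteIntersection m (fun _ : Fin c ↦ 2) Y → ∀ ⦃l : ℕ⦄, 2 * l + c ≤ m →
        ∀ x y : Motives.ChowGroup Y.left l, ∃ p q : ℤ, (p ≠ 0 ∨ q ≠ 0) ∧ p • x = q • y)
    (hbc : ∀ ⦃m c : ℕ⦄ ⦃X : Motives.SchemeOver ℂ⦄,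
      Motives.IsSmoothCompleteIntersection m (fun _ : Fin c ↦ 2) X →
        ∀ (L : Type) [Field L] [IsAlgClosed L] [Algebra ℂ L],
          Motives.IsSmoothCompleteIntersection m (fun _ : Fin c ↦ 2) ((Motives.baseChange ℂ L).obj X))
    {m c : ℕ} (hc : c ≤ 4) (hcm : c ≤ m) {X : Motives.SchemeOver ℂ}
    (hX : Motives.IsSmoothCompleteIntersection m (fun _ : Fin c ↦ 2) X) :
    HodgeConjectureFor m X :=
  hodgeConjectureFor_of_baseChange_ciQuadrics hCH hc hcm hX.1 (hbc hX)

/-- The literal multidegrees `![2, 2, 2]` and `![2, 2, 2, 2]` (the spellings used by the cell's per-series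
targets `HCThreeQuadrics` / `HCFourQuadrics`) are the constant family `2`. [folklore] -/
private theorem vecThree_two_eq_const : (![2, 2, 2] : Fin 3 → ℕ) = fun _ ↦ 2 := by
  funext i; fin_cases i <;> rfl

/-- See `vecThree_two_eq_const`. [folklore] -/
private theorem vecFour_two_eq_const : (![2, 2, 2, 2] : Fin 4 → ℕ) = fun _ ↦ 2 := by
  funext i; fin_cases i <;> rfl

/-- **The series `(2,2,2)^{2p} ⊂ ℙ^{2p+3}`, every `p ≥ 2`, every smooth member** (for `p = 1` the octic
K3 surface, Lefschetz (1,1), not this road): HC from the Chow input and the bridge. Generic members were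
in print (O'Grady 1986 — smooth discriminant; Terasoma 1988 Thm. 4.5.2).
[cite: Otwinowska1999b, Théorème (1)] [cite: Vial2013, Thm 7.1 (i)] -/
theorem hodgeConjectureFor_threeQuadrics_of_chow
    (hCH : ∀ ⦃k : Type⦄ [Field k] [IsAlgClosed k] [CharZero k] ⦃m c : ℕ⦄ ⦃Y : Motives.SchemeOver k⦄,
      Motives.IsSmoothCompleteIntersection m (fun _ : Fin c ↦ 2) Y → ∀ ⦃l : ℕ⦄, 2 * l + c ≤ m →
        ∀ x y : Motives.ChowGroup Y.left l, ∃ p q : ℤ, (p ≠ 0 ∨ q ≠ 0) ∧ p • x = q • y)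
    (hbc : ∀ ⦃m c : ℕ⦄ ⦃X : Motives.SchemeOver ℂ⦄,
      Motives.IsSmoothCompleteIntersection m (fun _ : Fin c ↦ 2) X →
        ∀ (L : Type) [Field L] [IsAlgClosed L] [Algebra ℂ L],
          Motives.IsSmoothCompleteIntersection m (fun _ : Fin c ↦ 2) ((Motives.baseChange ℂ L).obj X))
    {p : ℕ} (hp : 2 ≤ p) {X : Motives.SchemeOver ℂ}
    (hX : Motives.IsSmoothCompleteIntersection (2 * p) ![2, 2, 2] X) :
    HodgeConjectureFor (2 * p) X := by
  rw [vecThree_two_eq_const] at hX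
  exact hodgeConjectureFor_ciQuadrics_of_chow hCH hbc (by omega) (by omega) hX

/-- **The series `(2,2,2,2)^{2p} ⊂ ℙ^{2p+4}`, every `p ≥ 2`, every smooth member**: HC from the Chow
input and the bridge. Generic / regular members were in print (Terasoma 1988 Thm. 4.6.2; Nagel 2023
Cor. 5.5). [cite: Otwinowska1999b, Théorème (1)] [cite: Vial2013, Thm 7.1 (i)]
[cite: Terasoma1988QuadricCI, Thm 4.6.2] -/
theorem hodgeConjectureFor_fourQuadrics_of_chow
    (hCH : ∀ ⦃k : Type⦄ [Field k] [IsAlgClosed k] [CharZero k] ⦃m c : ℕ⦄ ⦃Y : Motives.SchemeOver k⦄,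
      Motives.IsSmoothCompleteIntersection m (fun _ : Fin c ↦ 2) Y → ∀ ⦃l : ℕ⦄, 2 * l + c ≤ m →
        ∀ x y : Motives.ChowGroup Y.left l, ∃ p q : ℤ, (p ≠ 0 ∨ q ≠ 0) ∧ p • x = q • y)
    (hbc : ∀ ⦃m c : ℕ⦄ ⦃X : Motives.SchemeOver ℂ⦄,
      Motives.IsSmoothCompleteIntersection m (fun _ : Fin c ↦ 2) X →
        ∀ (L : Type) [Field L] [IsAlgClosed L] [Algebra ℂ L],
          Motives.IsSmoothCompleteIntersection m (fun _ : Fin c ↦ 2) ((Motives.baseChange ℂ L).obj X))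
    {p : ℕ} (hp : 2 ≤ p) {X : Motives.SchemeOver ℂ}
    (hX : Motives.IsSmoothCompleteIntersection (2 * p) ![2, 2, 2, 2] X) :
    HodgeConjectureFor (2 * p) X := by
  rw [vecFour_two_eq_const] at hX
  exact hodgeConjectureFor_ciQuadrics_of_chow hCH hbc (by omega) (by omega) hX

/-- Upper bound (sanity): conversely the summit statement (HC for every smooth projective complex
variety, spelled with `HodgeConjectureFor`) contains the statement for complete intersections of quadrics
with all hypotheses dropped, so nothing beyond an instance family of the summit is assembled here.
[cite: Vial2013, Thm 7.1 (i)] -/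
theorem hodgeConjectureFor_ciQuadrics_of_hodgeConjectureFor
    (hHC : ∀ ⦃n : ℕ⦄ ⦃X : Motives.SchemeOver ℂ⦄, Motives.IsSmoothProjective n X → HodgeConjectureFor n X)
    {m c : ℕ} {X : Motives.SchemeOver ℂ} (hX : Motives.IsSmoothCompleteIntersection m (fun _ : Fin c ↦ 2) X) :
    HodgeConjectureFor m X :=
  hHC hX.1

end HodgeTheory

end Literature.AlgebraicGeometry.HodgeTheory

end
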